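import Literature.AlgebraicGeometry.Motives.HodgeLieWeightOneGradingSymmetry
import HarnessLib

/-!
# Weight-one Hodge structures with `dim 𝔤⁺ = dim 𝔤⁰ = 2`: Jordan form on a plane, the second Hodge–Riemann
# relation for a complex root vector, `𝔤⁰` abelian with a real element, an ambient basis of `𝔤⁺`

Family `hodge`, layer `Literature/AlgebraicGeometry/Motives`; THEOREMS ONLY (no definition, no named fact; D-0026).
Third abstract file (preliminaries) of the lane MT-RANK-SEVEN-SIMPLE of the cell `pub-hodgecm2` (COR-CM), seat `b27` gen 40.  Setting of
`Motives/HodgeLieWeightOneGrading{,Symmetry}`: `H` of weight `1`, polarization `ψ`, graded basis `e` with degrees in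
`{0,1}`, `P = gradingEnd e deg`, `𝔤 = 𝔥_ℂ`, `𝔤⁺ = 𝔤 ⊓ Eig₁(ad P)`, `𝔤⁻ = 𝔤 ⊓ Eig₋₁(ad P)`, `𝔤⁰ = 𝔤 ⊓ Eig₀(ad P)`,
and now `𝔷 = 𝔥 ∩ End_Hdg(V) = 0` (so `𝔤` is centre-free, `eq_zero_of_mem_hodgeLieC_of_forall_commute`) and
`dim 𝔤⁺ = dim 𝔤⁰ = 2` — the `Res_{K/ℚ} SL₂` position of the dichotomy `finrank_grading_of_finrank_eq_six`.

* §0 (linear algebra over `ℂ`) `basis_of_det_ne_zero`, `exists_jordan_pair` — a basis change with non-zero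
  determinant, and the Jordan form of an operator on a plane: `t E₁ = μ₁E₁`, `t E₂ = εE₁ + μ₂E₂` with `ε = 0` or
  (`ε = 1`, `μ₁ = μ₂`).
* §1 `mul_conjOp_ne_zero_of_plus` — **`E Ē ≠ 0 ≠ Ē E`** for `0 ≠ E ∈ 𝔤⁺` with conjugate `Ē` (second Hodge–Riemann
  relation at `u = E w ∈ V^{1,0}`: `ψ_ℂ(u, ū) = −ψ_ℂ(w, E Ē w̄)`).
* §2 `gradingZero_comm`, `exists_real_gradingZero` — `𝔤⁰ = ℂ(2P−1) ⊕ ℂY₀` is ABELIAN and contains a REAL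
  (`conj`-fixed) element `Y₀ ∉ ℂ(2P−1)`.
* §3 `exists_ambient_pair_gradingPlus` — an ambient basis `A₁, A₂` of the plane `𝔤⁺`.

These are the inputs of the structure theorem `exists_rootVectors` of the sequel
`Motives/HodgeLieWeightOneGradingTwoRoots` (root vectors `E₁, E₂, F₁ = Ē₁, F₂ = Ē₂` with
`E₁F₂ = F₂E₁ = E₂F₁ = F₁E₂ = 0`: two commuting `𝔰𝔩₂` over `ℂ`).

## References

* [Deligne1982HodgeCycles] P. Deligne, *Hodge cycles on abelian varieties*, LNM 900 (1982), I §3 (proof of Prop. 3.4,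
  3.6).
* [MoonenZarhin1999LowDim] B. Moonen, Yu. Zarhin, *Hodge classes on abelian varieties of low dimension*, Math. Ann. 315
  (1999), §2 and (2.3) (Hodge groups of simple abelian fourfolds: types I(2), II(2) with `Hg = Res SL₂`-forms).
* [Humphreys1972] J. E. Humphreys, *Introduction to Lie Algebras and Representation Theory*, GTM 9 (1972), §4.2
  (Jordan decomposition), §8.1.
* [Huybrechts2016K3] D. Huybrechts, *Lectures on K3 Surfaces* (2016), Thm. 3.3.9 (proof, p. 67: `Hg ⊆ Sp(ψ)`).
-/

noncomputable section

open scoped TensorProduct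

namespace Literature.AlgebraicGeometry.Motives

universe u

namespace HodgeStructure

open ProjectorBlocks Literature.RepresentationTheory.GeneralLinear

/-! ## §0 Linear algebra on a plane over `ℂ` -/

section Plane

variable {W : Type*} [AddCommGroup W] [Module ℂ W]

/-- **Basis change with non-zero determinant**: for `A₁, A₂` linearly independent and `Eᵢ = xᵢA₁ + yᵢA₂` with
`x₁y₂ − y₁x₂ ≠ 0`, the `Eᵢ` are linearly independent and `A₁, A₂` are combinations of `E₁, E₂` (Cramer).
[cite: Humphreys1972, §4.2] -/
theorem basis_of_det_ne_zero {A₁ A₂ E₁ E₂ : W} (hind : ∀ x y : ℂ, x • A₁ + y • A₂ = 0 → x = 0 ∧ y = 0)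
    {x₁ y₁ x₂ y₂ : ℂ} (hE₁ : E₁ = x₁ • A₁ + y₁ • A₂) (hE₂ : E₂ = x₂ • A₁ + y₂ • A₂)
    (hdet : x₁ * y₂ - y₁ * x₂ ≠ 0) :
    (∀ x y : ℂ, x • E₁ + y • E₂ = 0 → x = 0 ∧ y = 0) ∧
      A₁ = ((x₁ * y₂ - y₁ * x₂)⁻¹ * y₂) • E₁ + (-((x₁ * y₂ - y₁ * x₂)⁻¹ * y₁)) • E₂ ∧
      A₂ = (-((x₁ * y₂ - y₁ * x₂)⁻¹ * x₂)) • E₁ + ((x₁ * y₂ - y₁ * x₂)⁻¹ * x₁) • E₂ := by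
  set D := x₁ * y₂ - y₁ * x₂ with hD
  refine ⟨fun x y h => ?_, ?_, ?_⟩
  · rw [hE₁, hE₂] at h
    have h' : (x * x₁ + y * x₂) • A₁ + (x * y₁ + y * y₂) • A₂ = 0 := by rw [← h]; module
    obtain ⟨h1, h2⟩ := hind _ _ h'
    have hx : x * D = 0 := by linear_combination y₂ * h1 - x₂ * h2
    have hy : y * D = 0 := by linear_combination (-y₁) * h1 + x₁ * h2
    exact ⟨(mul_eq_zero.1 hx).resolve_right hdet, (mul_eq_zero.1 hy).resolve_right hdet⟩
  · rw [hE₁, hE₂]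
    have h1 : D⁻¹ * y₂ * x₁ + -(D⁻¹ * y₁) * x₂ = 1 := by
      rw [← sub_eq_zero]
      have : D⁻¹ * D = 1 := inv_mul_cancel₀ hdet
      linear_combination this
    have h2 : D⁻¹ * y₂ * y₁ + -(D⁻¹ * y₁) * y₂ = 0 := by ring
    calc A₁ = (1 : ℂ) • A₁ + (0 : ℂ) • A₂ := by rw [one_smul, zero_smul, add_zero]
      _ = (D⁻¹ * y₂ * x₁ + -(D⁻¹ * y₁) * x₂) • A₁ + (D⁻¹ * y₂ * y₁ + -(D⁻¹ * y₁) * y₂) • A₂ := by rw [h1, h2]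
      _ = (D⁻¹ * y₂) • (x₁ • A₁ + y₁ • A₂) + (-(D⁻¹ * y₁)) • (x₂ • A₁ + y₂ • A₂) := by module
  · rw [hE₁, hE₂]
    have h1 : -(D⁻¹ * x₂) * x₁ + D⁻¹ * x₁ * x₂ = 0 := by ring
    have h2 : -(D⁻¹ * x₂) * y₁ + D⁻¹ * x₁ * y₂ = 1 := by
      rw [← sub_eq_zero]
      have : D⁻¹ * D = 1 := inv_mul_cancel₀ hdet
      linear_combination this
    calc A₂ = (0 : ℂ) • A₁ + (1 : ℂ) • A₂ := by rw [one_smul, zero_smul, zero_add]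
      _ = (-(D⁻¹ * x₂) * x₁ + D⁻¹ * x₁ * x₂) • A₁ + (-(D⁻¹ * x₂) * y₁ + D⁻¹ * x₁ * y₂) • A₂ := by rw [h1, h2]
      _ = (-(D⁻¹ * x₂)) • (x₁ • A₁ + y₁ • A₂) + (D⁻¹ * x₁) • (x₂ • A₁ + y₂ • A₂) := by module

/-- **Jordan form on a plane.**  If `t` maps `A₁ ↦ aA₁ + cA₂`, `A₂ ↦ bA₁ + dA₂`, there are `Eᵢ = xᵢA₁ + yᵢA₂` with
`x₁y₂ − y₁x₂ ≠ 0` and `μ₁, μ₂, ε` with **`t E₁ = μ₁E₁`, `t E₂ = εE₁ + μ₂E₂`**, where `ε = 0` or (`ε = 1` and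
`μ₁ = μ₂`): the eigenvalues are `(a + d ± δ)/2`, `δ² = (a−d)² + 4bc` (`ℂ` is algebraically closed), with eigenvectors
`(μ − d)A₁ + cA₂` when `c ≠ 0`. [cite: Humphreys1972, §4.2] -/
theorem exists_jordan_pair (t : W →ₗ[ℂ] W) {A₁ A₂ : W} {a b c d : ℂ}
    (h1 : t A₁ = a • A₁ + c • A₂) (h2 : t A₂ = b • A₁ + d • A₂) :
    ∃ (E₁ E₂ : W) (μ₁ μ₂ ε x₁ y₁ x₂ y₂ : ℂ),
      E₁ = x₁ • A₁ + y₁ • A₂ ∧ E₂ = x₂ • A₁ + y₂ • A₂ ∧ x₁ * y₂ - y₁ * x₂ ≠ 0 ∧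
      t E₁ = μ₁ • E₁ ∧ t E₂ = ε • E₁ + μ₂ • E₂ ∧ (ε = 0 ∨ (ε = 1 ∧ μ₁ = μ₂)) := by
  have key : ∀ x y : ℂ, t (x • A₁ + y • A₂) = (x * a + y * b) • A₁ + (x * c + y * d) • A₂ := by
    intro x y; rw [map_add, map_smul, map_smul, h1, h2]; module
  by_cases hc : c = 0
  · by_cases hb : b = 0
    · -- diagonal
      refine ⟨A₁, A₂, a, d, 0, 1, 0, 0, 1, by module, by module, by norm_num, ?_, ?_, Or.inl rfl⟩
      · rw [h1, hc]; module
      · rw [h2, hb]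
    · by_cases had : a = d
      · -- Jordan block: `E₁ = b A₁`, `E₂ = A₂`
        refine ⟨b • A₁, A₂, a, a, 1, b, 0, 0, 1, by module, by module, ?_, ?_, ?_, Or.inr ⟨rfl, rfl⟩⟩
        · rw [zero_mul, mul_one, sub_zero]; exact hb
        · rw [map_smul, h1, hc]; module
        · rw [h2, had]; module
      · -- two eigenvalues `a ≠ d`: `E₂ = b A₁ + (d − a) A₂`
        refine ⟨A₁, b • A₁ + (d - a) • A₂, a, d, 0, 1, 0, b, d - a, by module, rfl, ?_, ?_, ?_, Or.inl rfl⟩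
        · rw [one_mul, zero_mul, sub_zero]; exact sub_ne_zero.2 (Ne.symm had)
        · rw [h1, hc]; module
        · rw [key, hc]; module
  · -- `c ≠ 0`: roots `(a + d ± δ)/2` of the characteristic polynomial, `δ² = (a − d)² + 4bc`
    obtain ⟨δ, hδ⟩ := IsAlgClosed.exists_eq_mul_self ((a - d) ^ 2 + 4 * b * c)
    by_cases hδ0 : δ = 0
    · -- double root `μ = (a+d)/2`: Jordan block `E₁ = (μ − d) A₁ + c A₂`, `E₂ = A₁`
      rw [hδ0, mul_zero] at hδ
      refine ⟨((a + d) / 2 - d) • A₁ + c • A₂, A₁, (a + d) / 2, (a + d) / 2, 1, (a + d) / 2 - d, c, 1, 0, rfl,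
        by module, ?_, ?_, ?_, Or.inr ⟨rfl, rfl⟩⟩
      · rw [mul_zero, mul_one, zero_sub, neg_ne_zero]; exact hc
      · rw [key]
        have e1 : ((a + d) / 2 - d) * a + c * b = (a + d) / 2 * ((a + d) / 2 - d) := by linear_combination hδ / 4
        have e2 : ((a + d) / 2 - d) * c + c * d = (a + d) / 2 * c := by ring
        rw [e1, e2]; module
      · rw [h1]; module
    · refine ⟨((a + d + δ) / 2 - d) • A₁ + c • A₂, ((a + d - δ) / 2 - d) • A₁ + c • A₂, (a + d + δ) / 2,
        (a + d - δ) / 2, 0, (a + d + δ) / 2 - d, c, (a + d - δ) / 2 - d, c, rfl, rfl, ?_, ?_, ?_, Or.inl rfl⟩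
      · have h : ((a + d + δ) / 2 - d) * c - c * ((a + d - δ) / 2 - d) = c * δ := by ring
        rw [h]; exact mul_ne_zero hc hδ0
      · rw [key]
        have e1 : ((a + d + δ) / 2 - d) * a + c * b = (a + d + δ) / 2 * ((a + d + δ) / 2 - d) := by
          linear_combination hδ / 4
        have e2 : ((a + d + δ) / 2 - d) * c + c * d = (a + d + δ) / 2 * c := by ring
        rw [e1, e2]; module
      · rw [key]
        have e1 : ((a + d - δ) / 2 - d) * a + c * b = (a + d - δ) / 2 * ((a + d - δ) / 2 - d) := by
          linear_combination hδ / 4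
        have e2 : ((a + d - δ) / 2 - d) * c + c * d = (a + d - δ) / 2 * c := by ring
        rw [e1, e2]; module

end Plane

variable {V : Type u} [AddCommGroup V] [Module ℚ V] [Module.Finite ℚ V] [HodgeTensorFacts.{u, u}] {n : ℤ}
  {S : Type u} [Fintype S] [DecidableEq S] {deg : S → ℤ}

/-! ## §1 Second Hodge–Riemann relation for a complex root vector -/

omit [Module.Finite ℚ V] [HodgeTensorFacts.{u, u}] [Fintype S] [DecidableEq S] in
/-- Conjugation of operators is additive, antilinear, involutive and multiplicative on the pointwise level used
below: `conj ((Y Z) (conj v)) = Ȳ (Z̄ v)`. [cite: Deligne1982HodgeCycles, I §3 (proof of Prop. 3.4)] -/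
theorem conjOp_mul_apply {Y Z Yb Zb : Module.End ℂ (ℂ ⊗[ℚ] V)} (hYb : ∀ v, Yb v = conj (Y (conj v)))
    (hZb : ∀ v, Zb v = conj (Z (conj v))) (v : ℂ ⊗[ℚ] V) : conj ((Y * Z) (conj v)) = (Yb * Zb) v := by
  rw [Module.End.mul_apply, Module.End.mul_apply, hYb, hZb, conj_conj]

/-- **`E Ē ≠ 0` and `Ē E ≠ 0` for a non-zero `E ∈ 𝔤⁺`** (`E ∈ 𝔥_ℂ`, `P E (1−P) = E`) with conjugate
`Ē = conj ∘ E ∘ conj` (weight `1`, `ψ` a polarization): for `u = E w ≠ 0` in `V^{1,0}`, `ū = Ē w̄` and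
`ψ_ℂ(u, ū) = −ψ_ℂ(w, E Ē w̄)` (`E` is `ψ_ℂ`-skew), against the second Hodge–Riemann relation; and `Ē E` is the
conjugate of `E Ē`. [cite: MoonenZarhin1999LowDim, §2] [cite: Huybrechts2016K3, Thm. 3.3.9 (proof, p. 67)] -/
theorem mul_conjOp_ne_zero_of_plus (H : HodgeStructure V n) (ψ : H.Polarization) (hn : n = 1)
    (e : Module.Basis S ℂ (ℂ ⊗[ℚ] V)) (hF : ∀ a, H.F a = Submodule.span ℂ (e '' {σ | a ≤ deg σ}))
    (hFc : ∀ a, complexConj (H.F a) = Submodule.span ℂ (e '' {σ | deg σ ≤ n - a}))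
    (hdeg : ∀ σ, deg σ = 0 ∨ deg σ = 1) {E Eb : Module.End ℂ (ℂ ⊗[ℚ] V)} (hEg : E ∈ H.hodgeLieC)
    (hE : gradingEnd e deg * E * (1 - gradingEnd e deg) = E) (hE0 : E ≠ 0)
    (hEb : ∀ v, Eb v = conj (E (conj v))) : E * Eb ≠ 0 ∧ Eb * E ≠ 0 := by
  classical
  subst hn
  have hPP := gradingEnd_mul_gradingEnd_of_deg e hdeg
  obtain ⟨hPE, -, -, -, -, -⟩ :=
    corner_identities (K := ℂ) hPP hE ((conjOp_grading H rfl e hF hFc hEb).1 hE)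
  have hEEb : E * Eb ≠ 0 := by
    intro h0
    obtain ⟨w, hw⟩ : ∃ w, E w ≠ 0 := by
      by_contra h
      push Not at h
      exact hE0 (LinearMap.ext fun w => by rw [h w, LinearMap.zero_apply])
    have hmem : E w ∈ H.piece 1 ((1 : ℤ) - 1) := by
      rw [piece_eq_span_of_graded H e hF hFc 1, ← hPE, Module.End.mul_apply]
      exact gradingEnd_apply_mem_span_one e hdeg _
    obtain ⟨r, hr, hre⟩ := ψ.pos 1 ((1 : ℤ) - 1) (by ring) (E w) hmem hw
    have hconj : conj (E w) = Eb (conj w) := by rw [hEb, conj_conj]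
    have hzero : ψ.form.baseChange ℂ (E w) (conj (E w)) = 0 := by
      rw [hconj, formBaseChange_skew_of_mem_hodgeLieC ψ hEg w (Eb (conj w)), ← Module.End.mul_apply, h0,
        LinearMap.zero_apply, map_zero, neg_zero]
    rw [hzero, mul_zero] at hre
    have hr0 : (r : ℂ) = 0 := hre.symm
    exact hr.ne' (by exact_mod_cast hr0)
  refine ⟨hEEb, fun h0 => hEEb (LinearMap.ext fun v => ?_)⟩
  -- `E Ē` is the conjugate of `Ē E`
  have hEbb : ∀ v, E v = conj (Eb (conj v)) := fun v => by rw [hEb, conj_conj, conj_conj]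
  have h := conjOp_mul_apply hEbb hEb v
  rw [h0, LinearMap.zero_apply, map_zero] at h
  rw [LinearMap.zero_apply, ← h]

/-! ## §2 `𝔤⁰` is abelian and has a real element outside `ℂ(2P − 1)` -/

/-- **`𝔤⁰` is abelian when `dim 𝔤⁰ = 2`**: it contains the Hodge operator `2P − 1 ≠ 0`, which commutes with every
block-diagonal operator, so `𝔤⁰ = ℂ(2P−1) + ℂY` for any `Y ∈ 𝔤⁰ ∖ ℂ(2P−1)`. [cite: Deligne1982HodgeCycles, I §3 (proof of Prop. 3.4)]
[cite: MoonenZarhin1999LowDim, §2 and (2.3)] -/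
theorem gradingZero_comm (H : HodgeStructure V n) (hn : n = 1) (e : Module.Basis S ℂ (ℂ ⊗[ℚ] V))
    (hF : ∀ a, H.F a = Submodule.span ℂ (e '' {σ | a ≤ deg σ}))
    (hFc : ∀ a, complexConj (H.F a) = Submodule.span ℂ (e '' {σ | deg σ ≤ n - a}))
    (hΘ0 : (2 : ℂ) • gradingEnd e deg - 1 ≠ 0)
    (h02 : Module.finrank ℂ (H.hodgeLieC ⊓ Module.End.eigenspace
        (LinearMap.mulLeft ℂ (gradingEnd e deg) - LinearMap.mulRight ℂ (gradingEnd e deg)) 0 : Submodule ℂ _) = 2)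
    {Y Y' : Module.End ℂ (ℂ ⊗[ℚ] V)}
    (hY : Y ∈ (H.hodgeLieC ⊓ Module.End.eigenspace
        (LinearMap.mulLeft ℂ (gradingEnd e deg) - LinearMap.mulRight ℂ (gradingEnd e deg)) 0 : Submodule ℂ _))
    (hY' : Y' ∈ (H.hodgeLieC ⊓ Module.End.eigenspace
        (LinearMap.mulLeft ℂ (gradingEnd e deg) - LinearMap.mulRight ℂ (gradingEnd e deg)) 0 : Submodule ℂ _)) :
    Y * Y' = Y' * Y := by
  set P := gradingEnd e deg with hP
  set G0 : Submodule ℂ (Module.End ℂ (ℂ ⊗[ℚ] V)) := H.hodgeLieC ⊓ Module.End.eigenspace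
      (LinearMap.mulLeft ℂ P - LinearMap.mulRight ℂ P) 0 with hG0
  set Θ : Module.End ℂ (ℂ ⊗[ℚ] V) := (2 : ℂ) • P - 1 with hΘdef
  have hΘ : Θ ∈ G0 := theta_mem_gradingZero H hn e hF hFc
  -- `Θ` commutes with every block-diagonal operator
  have hΘcomm : ∀ Z ∈ G0, Θ * Z = Z * Θ := by
    rintro Z ⟨-, hZ⟩
    rw [SetLike.mem_coe, mem_eigenspace_adP_zero_iff] at hZ
    rw [hΘdef, sub_mul, mul_sub, smul_mul_assoc, mul_smul_comm, hZ, one_mul, mul_one]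
  by_cases hYΘ : Y ∈ Submodule.span ℂ {Θ}
  · obtain ⟨c, rfl⟩ := Submodule.mem_span_singleton.1 hYΘ
    rw [smul_mul_assoc, mul_smul_comm, hΘcomm Y' hY']
  · -- `Θ, Y` independent, hence a basis of the plane `G0`; `Y' = aΘ + bY`
    have hind : LinearIndependent ℂ ![Θ, Y] := by
      refine LinearIndependent.pair_iff.2 fun s t hst => ?_
      by_cases ht : t = 0
      · rw [ht, zero_smul, add_zero] at hst
        exact ⟨(smul_eq_zero.1 hst).resolve_right hΘ0, ht⟩
      · exfalso; apply hYΘ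
        rw [Submodule.mem_span_singleton]
        refine ⟨-(t⁻¹ * s), ?_⟩
        have h : t • Y = -(s • Θ) := eq_neg_of_add_eq_zero_right hst
        calc -(t⁻¹ * s) • Θ = t⁻¹ • (-(s • Θ)) := by module
          _ = Y := by rw [← h, smul_smul, inv_mul_cancel₀ ht, one_smul]
    have hle : Submodule.span ℂ (Set.range ![Θ, Y]) ≤ G0 := by
      rw [Submodule.span_le, Set.range_subset_iff]
      intro i; fin_cases i
      · exact hΘ
      · exact hY
    have hdim : Module.finrank ℂ G0 ≤ Module.finrank ℂ (Submodule.span ℂ (Set.range ![Θ, Y])) := by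
      rw [finrank_span_eq_card hind, Fintype.card_fin, hG0, h02]
    have heq := Submodule.eq_of_le_of_finrank_le hle hdim
    have hY'' : Y' ∈ Submodule.span ℂ (Set.range ![Θ, Y]) := by rw [heq]; exact hY'
    rw [Matrix.range_cons, Matrix.range_cons, Matrix.range_empty, Set.union_empty, Set.singleton_union,
      Submodule.mem_span_pair] at hY''
    obtain ⟨a, b, rfl⟩ := hY''
    rw [mul_add, add_mul, mul_smul_comm, mul_smul_comm, smul_mul_assoc, smul_mul_assoc, hΘcomm Y hY]

/-- **A real element of `𝔤⁰` outside `ℂ(2P − 1)`** when `dim 𝔤⁰ = 2`: `𝔤⁰` is `conj`-stable (`𝔤` is, and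
conjugation preserves `Eig₀`), so with `Y ∈ 𝔤⁰ ∖ ℂ(2P−1)` one of the real elements `Y + Ȳ`, `i(Y − Ȳ)` is outside
`ℂ(2P−1)` (`2Y = (Y + Ȳ) − i·i(Y − Ȳ)`). [cite: Deligne1982HodgeCycles, I §3 (proof of Prop. 3.4)] -/
theorem exists_real_gradingZero (H : HodgeStructure V n) (hn : n = 1) (e : Module.Basis S ℂ (ℂ ⊗[ℚ] V))
    (hF : ∀ a, H.F a = Submodule.span ℂ (e '' {σ | a ≤ deg σ}))
    (hFc : ∀ a, complexConj (H.F a) = Submodule.span ℂ (e '' {σ | deg σ ≤ n - a}))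
    (h02 : Module.finrank ℂ (H.hodgeLieC ⊓ Module.End.eigenspace
        (LinearMap.mulLeft ℂ (gradingEnd e deg) - LinearMap.mulRight ℂ (gradingEnd e deg)) 0 : Submodule ℂ _) = 2) :
    ∃ Y₀ : Module.End ℂ (ℂ ⊗[ℚ] V), Y₀ ∈ (H.hodgeLieC ⊓ Module.End.eigenspace
        (LinearMap.mulLeft ℂ (gradingEnd e deg) - LinearMap.mulRight ℂ (gradingEnd e deg)) 0 : Submodule ℂ _) ∧
      (∀ v, Y₀ v = conj (Y₀ (conj v))) ∧ Y₀ ∉ Submodule.span ℂ {(2 : ℂ) • gradingEnd e deg - 1} := by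
  set P := gradingEnd e deg with hP
  set G0 : Submodule ℂ (Module.End ℂ (ℂ ⊗[ℚ] V)) := H.hodgeLieC ⊓ Module.End.eigenspace
      (LinearMap.mulLeft ℂ P - LinearMap.mulRight ℂ P) 0 with hG0
  set Θ : Module.End ℂ (ℂ ⊗[ℚ] V) := (2 : ℂ) • P - 1 with hΘdef
  have hΘ : Θ ∈ G0 := theta_mem_gradingZero H hn e hF hFc
  -- some `Y ∈ G0` outside the line `ℂΘ`
  have hlt : Submodule.span ℂ {Θ} < G0 := by
    refine Submodule.lt_of_le_of_finrank_lt_finrank ((Submodule.span_singleton_le_iff_mem _ _).2 hΘ) ?_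
    rw [hG0, h02]
    exact (finrank_span_le_card ({Θ} : Set (Module.End ℂ (ℂ ⊗[ℚ] V)))).trans_lt (by simp)
  obtain ⟨Y, hYG, hYΘ⟩ := SetLike.exists_of_lt hlt
  obtain ⟨Yb, hYb⟩ := exists_conjOp Y
  -- `Ȳ ∈ G0`
  have hYbG : Yb ∈ G0 := by
    obtain ⟨hYg, hY0⟩ := hYG
    refine ⟨?_, ?_⟩
    · rw [hodgeLieC_eq_spanC] at hYg ⊢
      exact conjOp_mem_spanC hYg hYb
    · rw [SetLike.mem_coe, mem_eigenspace_adP_zero_iff] at hY0 ⊢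
      exact (conjOp_grading H hn e hF hFc hYb).2.2 hY0
  -- the two real candidates
  have hre1 : ∀ v, (Y + Yb) v = conj ((Y + Yb) (conj v)) := fun v => by
    rw [LinearMap.add_apply, LinearMap.add_apply, map_add, hYb v, hYb (conj v), conj_conj, conj_conj, add_comm]
  have hre2 : ∀ v, (Complex.I • (Y - Yb)) v = conj ((Complex.I • (Y - Yb)) (conj v)) := fun v => by
    rw [LinearMap.smul_apply, LinearMap.smul_apply, LinearMap.sub_apply, LinearMap.sub_apply, conj_smul, map_sub,
      Complex.conj_I, hYb v, hYb (conj v), conj_conj, conj_conj, neg_smul, ← smul_neg, neg_sub]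
  by_cases h1 : Y + Yb ∈ Submodule.span ℂ {Θ}
  · by_cases h2 : Complex.I • (Y - Yb) ∈ Submodule.span ℂ {Θ}
    · exfalso; apply hYΘ
      -- `Y = 2⁻¹ • ((Y + Ȳ) - i • (i • (Y - Ȳ)))`
      have h : Y = (2 : ℂ)⁻¹ • ((Y + Yb) - Complex.I • (Complex.I • (Y - Yb))) := by
        rw [smul_smul, Complex.I_mul_I, neg_one_smul, sub_neg_eq_add, add_add_sub_cancel, ← two_smul ℂ Y, smul_smul,
          inv_mul_cancel₀ (two_ne_zero' ℂ), one_smul]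
      rw [h]
      exact Submodule.smul_mem _ _ (Submodule.sub_mem _ h1 (Submodule.smul_mem _ _ h2))
    · exact ⟨_, Submodule.smul_mem _ _ (Submodule.sub_mem _ hYG hYbG), hre2, h2⟩
  · exact ⟨_, Submodule.add_mem _ hYG hYbG, hre1, h1⟩

/-! ## §3 An ambient basis of the plane `𝔤⁺` -/

omit [HodgeTensorFacts.{u, u}] [Fintype S] [DecidableEq S] in
/-- **An ambient basis of a complex plane** `G ⊆ End_ℂ(V_ℂ)` (`dim G = 2`): `A₁, A₂ ∈ G` linearly independent with
`G ∋ E ⟹ E = xA₁ + yA₂` (coordinates through `Basis.equivFun`). [cite: Humphreys1972, §4.2] -/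
theorem exists_ambient_pair {G : Submodule ℂ (Module.End ℂ (ℂ ⊗[ℚ] V))} (hG : Module.finrank ℂ G = 2) :
    ∃ A₁ A₂ : Module.End ℂ (ℂ ⊗[ℚ] V), A₁ ∈ G ∧ A₂ ∈ G ∧ (∀ x y : ℂ, x • A₁ + y • A₂ = 0 → x = 0 ∧ y = 0) ∧
      ∀ E ∈ G, ∃ x y : ℂ, E = x • A₁ + y • A₂ := by
  haveI : Module.Free ℂ G := Module.Free.of_divisionRing ℂ G
  obtain ⟨b⟩ : Nonempty (Module.Basis (Fin 2) ℂ G) := ⟨(Module.finBasis ℂ G).reindex (finCongr hG)⟩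
  refine ⟨(b 0 : Module.End ℂ (ℂ ⊗[ℚ] V)), (b 1 : Module.End ℂ (ℂ ⊗[ℚ] V)), (b 0).2, (b 1).2, fun x y h => ?_,
    fun E hE => ?_⟩
  · have h3 : ((b.equivFun.symm ![x, y] : G) : Module.End ℂ (ℂ ⊗[ℚ] V)) = 0 := by
      rw [Module.Basis.equivFun_symm_apply, Submodule.coe_sum, Fin.sum_univ_two]
      simpa only [Submodule.coe_smul, Matrix.cons_val_zero, Matrix.cons_val_one] using h
    have h4 : (![x, y] : Fin 2 → ℂ) = 0 := by
      have h := congrArg b.equivFun (Subtype.ext h3 : b.equivFun.symm _ = 0)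
      rwa [LinearEquiv.apply_symm_apply, map_zero] at h
    exact ⟨by simpa using congrFun h4 0, by simpa using congrFun h4 1⟩
  · refine ⟨b.equivFun ⟨E, hE⟩ 0, b.equivFun ⟨E, hE⟩ 1, ?_⟩
    have h := b.equivFun.symm_apply_apply ⟨E, hE⟩
    rw [Module.Basis.equivFun_symm_apply, Fin.sum_univ_two] at h
    have h' := congrArg Subtype.val h
    simpa only [Submodule.coe_add, Submodule.coe_smul] using h'.symm

end HodgeStructure

end Literature.AlgebraicGeometry.Motives

end
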